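import Literature.AlgebraicTopology.SingularHomology.MayerVietorisExactness
import Literature.AlgebraicTopology.SingularHomology.ExcisionTheorem
import Literature.AlgebraicTopology.SingularHomology.ExcisionMayerVietorisProofs
import Literature.AlgebraicTopology.SingularHomology.LocalHomologyVanishing
import Literature.AlgebraicTopology.SingularHomology.SphereHomology
import Literature.AlgebraicTopology.SingularHomology.CollapseMap
import Literature.AlgebraicTopology.SingularHomology.UniversalCoefficientsFree
import Literature.AlgebraicTopology.SingularHomology.CupProduct
import Literature.AlgebraicTopology.SingularHomology.CohomologyOfPoint
import Literature.Topology.FourManifolds.ClosedModelRelOrientation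
import Literature.Topology.FourManifolds.HomotopySpheresE8GramReduction
import Mathlib.Algebra.Category.ModuleCat.Biproducts
import Mathlib.Geometry.Manifold.Instances.Sphere
import Mathlib.Analysis.Convex.Contractible
import HarnessLib

/-!
# The middle homology and cohomology of `Sᵏ × Sᵏ`: the two slices and their dual classes

Topic `Literature/Topology/FourManifolds`; sixth pure-proof companion of the named fact
`Literature.Topology.FourManifolds.HomotopySphere.exists_intersectionForm_equivalent_e8Form`
(`HomotopySpheresBPOrderSignatureLeaves.lean`; A. Kosinski, *Differential Manifolds* (1993),
VI.12: Milnor's plumbing `M(4n)` along the `E₈` tree has intersection matrix `Γ₈`). Everything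
here is **proved**; no definition, no named fact (D-0026).

The pieces of the plumbing are tubes `N_c = {⟪p, q⟫ ≥ c}` of the diagonal `Δ ⊂ Sᵏ × Sᵏ`
(`SphereProductTube.lean`; Milnor–Stasheff, *Characteristic classes* (1974), Lemma 11.5: the
normal bundle of `Δ` is the tangent bundle), and the diagonal entry `[Σ : Σ] = 2` of `Γ₈`
(Kosinski VI.(12.4), `φ_*(τ₂ₙ) = 2` for `k = 2n` even) is to be read on the closed manifold
`Q = Sᵏ × Sᵏ` through the collapse `Q → N̂_c`, where it becomes the statement that the Poincaré
dual `α + β` of `Δ` has square `2αβ`, `⟨αβ, [Q]⟩ = ±1`. This file supplies the (co)homology of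
`Q` that this computation uses — A. Hatcher, *Algebraic Topology* (2002), Example 3.11 /
Thm. 3B.6 (`H*(Sᵏ × Sᵏ)`), here in the middle degree and PROVED from first principles by
Mayer–Vietoris (§2.2), without a Künneth theorem:

* `Literature.Topology.FourManifolds.mayerVietoris.isIso_ψ_of_isZero` — for an open cover
  `X = U ∪ V` with `Hₙ₊₁(U ∩ V) = Hₙ(U ∩ V) = 0`, `Hₙ₊₁(U) ⊕ Hₙ₊₁(V) ≅ Hₙ₊₁(X)` (exactness of the
  Mayer–Vietoris sequence, tree theorems `mayerVietoris.exact₁_holds`, `exact₂_holds`);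
* `Literature.Topology.FourManifolds.isIso_map_subsetIncl_compl_singleton` — removing a point
  `x` with `Hⱼ(X | x) = 0` (`j = n + 1, n + 2`) does not change `Hₙ₊₁` (exact sequence of the
  pair, Thm. 2.16);
* `Literature.Topology.FourManifolds.exists_prodHomotopyEquivSnd` (`…Fst`),
  `isIso_map_prodMk_const_left` (`…right`) — `C × Y ≃ₕ Y` for `C` contractible, so a slice
  `y ↦ (c₀, y)` is a homology isomorphism (Cor. 2.11);
* `Literature.Topology.FourManifolds.isIso_ψ_puncturedSphereProd` — the punctured product
  `Sᵏ × Sᵏ ∖ (v, v)` is covered by `{x₁ ≠ v} ≅ (Sᵏ ∖ v) × Sᵏ` and `{x₂ ≠ v} ≅ Sᵏ × (Sᵏ ∖ v)` with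
  CONTRACTIBLE intersection `(Sᵏ ∖ v)²` (stereographic projection), so
  `Hⱼ₊₁({x₁ ≠ v}) ⊕ Hⱼ₊₁({x₂ ≠ v}) ≅ Hⱼ₊₁(Sᵏ × Sᵏ ∖ (v, v))` for `j ≥ 1`;
* `Literature.Topology.FourManifolds.isIso_map_subsetIncl_puncturedSphereProd` — filling the
  puncture back in is an isomorphism on `Hⱼ₊₁` for `j + 2 < 2k` (local homology of the
  `2k`-manifold `Sᵏ × Sᵏ`, read in a product chart, `isZero_localHomology_of_chart`);
* `Literature.Topology.FourManifolds.isIso_biprodDesc_slices` (`…_middle`) — **the slice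
  isomorphism**: for all `p, q ∈ Sᵏ` (`k ≥ 1`) and `1 ≤ j`, `j + 2 < 2k`,
  `(x, y) ↦ (p, -)_* x + (-, q)_* y : Hⱼ₊₁(Sᵏ) ⊕ Hⱼ₊₁(Sᵏ) ≅ Hⱼ₊₁(Sᵏ × Sᵏ)`; in particular
  `Hₖ(Sᵏ × Sᵏ; ℤ) ≅ ℤ²` on the vertical and the horizontal slice (`k ≥ 2`), and
  `Literature.Topology.FourManifolds.isZero_singularHomology_sphereProd`: `Hⱼ(Sᵏ × Sᵏ; ℤ) = 0`
  for `2 ≤ j ≠ k`, `j + 1 < 2k`;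
* `Literature.Topology.FourManifolds.exists_generator_sphere`, `kroneckerPairing_slices`,
  `cupProduct_pullback_sphere_eq_zero` — the generator `g = e⁻¹ 1` of `Hₖ(Sᵏ) ≅ ℤ` with its dual
  class `σ` (`⟨σ, x⟩ = e x`, Thm. 3.2), the classes `α = pr₁^* σ`, `β = pr₂^* σ` Kronecker-dual to
  the slices `A₁ = (-, q)_* g`, `A₂ = (p, -)_* g` (`⟨α, A₁⟩ = 1 = ⟨β, A₂⟩`,
  `⟨α, A₂⟩ = 0 = ⟨β, A₁⟩`), and `α ⌣ α = 0 = β ⌣ β` (pulled back from `H²ᵏ(Sᵏ) = 0`, Prop. 3.10);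
* `Literature.Topology.FourManifolds.exists_basis_freeCohomology_sphereProd` — **the middle
  cohomology lattice** (`k ≥ 3`): `Hᵏ(Sᵏ × Sᵏ; ℤ)` is finitely generated and `Hᵏ(Sᵏ × Sᵏ; ℤ)/T`
  is free of rank `2` with basis `(ᾱ, β̄)` (`Hₖ₋₁ = 0`, so `Hᵏ ≅ Hom(Hₖ, ℤ)` is torsion-free,
  Thm. 3.2; `exists_basis_of_isUnit_eval` on the unit matrix `(⟨cᵢ, Aⱼ⟩)`).

With Poincaré duality on the closed oriented `2k`-manifold `Sᵏ × Sᵏ` (Hatcher Prop. 3.38, tree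
theorem `isPerfPair_cupPairingModTorsion_holds`) the last item gives `⟨α ⌣ β, [Sᵏ × Sᵏ]⟩ = ±1`
for `k` even — the cup-product ring of `Sᵏ × Sᵏ` in the middle degree (Example 3.11) — in the
sequel, where the manifold structure enters.

## References

* A. Hatcher, *Algebraic Topology*, CUP 2002: Ch. 0 p. 4 (contractible spaces), Prop. 1.14
  (stereographic projection), Cor. 2.11, Cor. 2.14, Thm. 2.16, §2.2 pp. 149–150
  (Mayer–Vietoris), §3.1 p. 201 and Thm. 3.2, Prop. 3.10, Example 3.11, §3.3 p. 231 (local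
  homology), Thm. 3B.6 (Künneth; not used). [HatcherAT2002]
* A. Kosinski, *Differential Manifolds* (1993), VI.12 ((12.4), the matrix `Γ₈`, p. 122).
  [Kosinski1993]
* J. Milnor, J. Stasheff, *Characteristic classes* (1974), §11, Lemma 11.5. [MilnorStasheff1974]
-/

open scoped Topology
open Set Function CategoryTheory CategoryTheory.Limits

noncomputable section

namespace Literature.Topology.FourManifolds

open Literature.AlgebraicTopology.SingularHomology

universe u

/-! ### Mayer–Vietoris with acyclic intersection; removing a point -/

section Generalities

variable {X : Type} [TopologicalSpace X]

/-- **Mayer–Vietoris with an intersection acyclic in two consecutive degrees**: for an open cover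
`X = U ∪ V` with `Hₙ₊₁(U ∩ V) = Hₙ(U ∩ V) = 0`, the sum of the two inclusions
`Hₙ₊₁(U) ⊞ Hₙ₊₁(V) → Hₙ₊₁(X)` is an isomorphism (Hatcher 2002, §2.2, p. 149: exactness of
`Hₙ₊₁(U ∩ V) → Hₙ₊₁(U) ⊕ Hₙ₊₁(V) → Hₙ₊₁(X) → Hₙ(U ∩ V)`). [cite: HatcherAT2002, §2.2 p. 149] -/
theorem mayerVietoris.isIso_ψ_of_isZero (U V : Set X) (hU : IsOpen U) (hV : IsOpen V)
    (hUV : U ∪ V = univ) (n : ℕ) (h₁ : IsZero (singularHomology ℤ ℤ ↥(U ∩ V) (n + 1)))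
    (h₀ : IsZero (singularHomology ℤ ℤ ↥(U ∩ V) n)) :
    IsIso (mayerVietoris.ψ ℤ ℤ U V (n + 1)) := by
  have hint : interior U ∪ interior V = univ := by rw [hU.interior_eq, hV.interior_eq, hUV]
  have hexc := relativeSingularHomology.isIso_map_of_interior_union_interior_holds ℤ ℤ X
  haveI : Mono (mayerVietoris.ψ ℤ ℤ U V (n + 1)) :=
    (mayerVietoris.exact₁_holds ℤ ℤ U V hint (n + 1)).mono_g (h₁.eq_of_src _ _)
  haveI : Epi (mayerVietoris.ψ ℤ ℤ U V (n + 1)) :=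
    (mayerVietoris.exact₂_holds ℤ ℤ U V hexc hint n).epi_f (h₀.eq_of_tgt _ _)
  exact isIso_of_mono_of_epi _

/-- **Removing a point does not change homology away from the top**: if the local homology
`Hⱼ(X | x)` vanishes for `j = n + 1, n + 2` then the inclusion `X ∖ {x} ↪ X` induces an
isomorphism on `Hₙ₊₁` (exact sequence of the pair `(X, X ∖ {x})`, Hatcher 2002, Thm. 2.16; for
an `m`-manifold and `n + 2 < m`… here in the form of the two vanishing hypotheses).
[cite: HatcherAT2002, Thm. 2.16 with §3.3 p. 231] -/
theorem isIso_map_subsetIncl_compl_singleton (x : X) (n : ℕ)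
    (h₁ : IsZero (localHomology ℤ ℤ X x (n + 1))) (h₂ : IsZero (localHomology ℤ ℤ X x (n + 2))) :
    IsIso (singularHomology.map ℤ ℤ (subsetIncl ({x}ᶜ : Set X)) (n + 1)) := by
  haveI : Epi (singularHomology.map ℤ ℤ (subsetIncl ({x}ᶜ : Set X)) (n + 1)) :=
    (relativeSingularHomology.exact_map_ofAbsolute ℤ ℤ ({x}ᶜ : Set X) (n + 1)).epi_f
      (h₁.eq_of_tgt _ _)
  haveI : Mono (singularHomology.map ℤ ℤ (subsetIncl ({x}ᶜ : Set X)) (n + 1)) :=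
    (relativeSingularHomology.exact_δ_map ℤ ℤ ({x}ᶜ : Set X) (n + 1)).mono_g (h₂.eq_of_src _ _)
  exact isIso_of_mono_of_epi _

end Generalities

/-! ### Homotopy equivalences with a contractible factor -/

section Contractible

variable {C Y : Type} [TopologicalSpace C] [TopologicalSpace Y]

/-- In a contractible space the identity is homotopic to every constant map. [folklore] -/
theorem homotopic_id_const [ContractibleSpace C] (c₀ : C) :
    (ContinuousMap.id C).Homotopic (ContinuousMap.const C c₀) := by
  obtain ⟨c₁, h₁⟩ := id_nullhomotopic C
  exact h₁.trans (ContinuousMap.homotopic_const_iff.2 (PathConnectedSpace.joined c₁ c₀))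

/-- **`C × Y ≃ₕ Y` for `C` contractible**: the projection, with homotopy inverse `y ↦ (c₀, y)` for
any `c₀ ∈ C` (Hatcher 2002, Ch. 0, contractible spaces). [cite: HatcherAT2002, Ch. 0 p. 4] -/
theorem exists_prodHomotopyEquivSnd [ContractibleSpace C] (c₀ : C) :
    ∃ e : ContinuousMap.HomotopyEquiv (C × Y) Y, (e.toFun : C × Y → Y) = Prod.snd ∧
      (e.invFun : Y → C × Y) = fun y => (c₀, y) :=
  ⟨{ toFun := ⟨Prod.snd, continuous_snd⟩
     invFun := ⟨fun y => (c₀, y), (Continuous.prodMk continuous_const continuous_id)⟩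
     left_inv := (homotopic_id_const c₀).symm.prodMap
       (ContinuousMap.Homotopic.refl (ContinuousMap.id Y))
     right_inv := ContinuousMap.Homotopic.refl _ }, rfl, rfl⟩

/-- **`Y × C ≃ₕ Y` for `C` contractible**: the projection, with homotopy inverse `y ↦ (y, c₀)`.
[cite: HatcherAT2002, Ch. 0 p. 4] -/
theorem exists_prodHomotopyEquivFst [ContractibleSpace C] (c₀ : C) :
    ∃ e : ContinuousMap.HomotopyEquiv (Y × C) Y, (e.toFun : Y × C → Y) = Prod.fst ∧
      (e.invFun : Y → Y × C) = fun y => (y, c₀) :=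
  ⟨{ toFun := ⟨Prod.fst, continuous_fst⟩
     invFun := ⟨fun y => (y, c₀), (Continuous.prodMk continuous_id continuous_const)⟩
     left_inv := (ContinuousMap.Homotopic.refl (ContinuousMap.id Y)).prodMap
       (homotopic_id_const c₀).symm
     right_inv := ContinuousMap.Homotopic.refl _ }, rfl, rfl⟩

/-- For `C` contractible and `c₀ ∈ C`, `y ↦ (c₀, y) : Y → C × Y` induces isomorphisms on
homology (it is a homotopy inverse of the projection; Hatcher 2002, Cor. 2.11). [cite: HatcherAT2002, Cor. 2.11] -/
theorem isIso_map_prodMk_const_left [ContractibleSpace C] (c₀ : C) (j : ℕ) :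
    IsIso (singularHomology.map ℤ ℤ
      (⟨fun y => (c₀, y), Continuous.prodMk continuous_const continuous_id⟩ : C(Y, C × Y)) j) := by
  obtain ⟨e, -, he⟩ := exists_prodHomotopyEquivSnd (Y := Y) c₀
  have h := isIso_map_of_homotopyEquiv ℤ ℤ e.symm j
  have : (e.symm.toFun : C(Y, C × Y)) =
      ⟨fun y => (c₀, y), Continuous.prodMk continuous_const continuous_id⟩ := by
    ext y <;> simp [ContinuousMap.HomotopyEquiv.symm, he]
  rwa [this] at h

/-- For `C` contractible and `c₀ ∈ C`, `y ↦ (y, c₀) : Y → Y × C` induces isomorphisms on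
homology. [cite: HatcherAT2002, Cor. 2.11] -/
theorem isIso_map_prodMk_const_right [ContractibleSpace C] (c₀ : C) (j : ℕ) :
    IsIso (singularHomology.map ℤ ℤ
      (⟨fun y => (y, c₀), Continuous.prodMk continuous_id continuous_const⟩ : C(Y, Y × C)) j) := by
  obtain ⟨e, -, he⟩ := exists_prodHomotopyEquivFst (Y := Y) c₀
  have h := isIso_map_of_homotopyEquiv ℤ ℤ e.symm j
  have : (e.symm.toFun : C(Y, Y × C)) =
      ⟨fun y => (y, c₀), Continuous.prodMk continuous_id continuous_const⟩ := by
    ext y <;> simp [ContinuousMap.HomotopyEquiv.symm, he]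
  rwa [this] at h

end Contractible

/-- Precomposition with a homeomorphism preserves "induces an isomorphism on `Hⱼ`". [folklore] -/
theorem isIso_map_homeomorph_comp {A B Y : Type} [TopologicalSpace A] [TopologicalSpace B]
    [TopologicalSpace Y] (φ : B ≃ₜ A) (g : C(Y, B)) (j : ℕ)
    [IsIso (singularHomology.map ℤ ℤ g j)] :
    IsIso (singularHomology.map ℤ ℤ ((φ : C(B, A)).comp g) j) := by
  rw [singularHomology.map_comp]
  haveI : IsIso (singularHomology.map ℤ ℤ (φ : C(B, A)) j) :=
    (singularHomology.mapIso ℤ ℤ φ j).isIso_hom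
  infer_instance

/-! ### The product of two spheres: Mayer–Vietoris for the punctured product -/

section SphereProd

variable {k : ℕ}

/-- The punctured product `Sᵏ × Sᵏ ∖ {(v, v)}` is covered by the two open sets `{x₁ ≠ v}`,
`{x₂ ≠ v}`. [folklore] -/
theorem union_fst_ne_snd_ne (v : (Metric.sphere (0 : EuclideanSpace ℝ (Fin (k + 1))) 1)) :
    ({x | x.1.1 ≠ v} : Set ↥({((v, v) : (Metric.sphere (0 : EuclideanSpace ℝ (Fin (k + 1))) 1) × (Metric.sphere
            (0 : EuclideanSpace ℝ (Fin (k + 1))) 1))}ᶜ : Set ((Metric.sphere (0 : EuclideanSpace ℝ (Fin (k +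
            1))) 1) × (Metric.sphere (0 : EuclideanSpace ℝ (Fin (k + 1))) 1)))) ∪ {x | x.1.2 ≠ v} = univ := by
  refine eq_univ_of_forall fun x => ?_
  by_contra h
  simp only [mem_union, mem_setOf_eq, not_or, not_not] at h
  exact x.2 (Prod.ext h.1 h.2)

/-- `{x₁ ≠ v} ∩ {x₂ ≠ v}` in the punctured product is homeomorphic to `(Sᵏ ∖ v) × (Sᵏ ∖ v)`,
hence contractible. [folklore] -/
theorem contractibleSpace_fst_ne_inter_snd_ne (v : (Metric.sphere (0 : EuclideanSpace ℝ (Fin (k + 1))) 1)) :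
    ContractibleSpace ↥(({x | x.1.1 ≠ v} : Set ↥({((v, v) : (Metric.sphere (0 : EuclideanSpace ℝ (Fin (k + 1)))
            1) × (Metric.sphere (0 : EuclideanSpace ℝ (Fin (k +
            1))) 1))}ᶜ : Set ((Metric.sphere (0 : EuclideanSpace ℝ (Fin (k + 1))) 1) × (Metric.sphere (0 : EuclideanSpace ℝ (Fin (k + 1))) 1)))) ∩
      {x | x.1.2 ≠ v}) := by
  haveI := contractibleSpace_sphere_compl_singleton (n := k) v
  let φ : ↥(({x | x.1.1 ≠ v} : Set ↥({((v, v) : (Metric.sphere (0 : EuclideanSpace ℝ (Fin (k + 1))) 1) ×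
          (Metric.sphere (0 : EuclideanSpace ℝ (Fin (k + 1))) 1))}ᶜ : Set ((Metric.sphere (0 : EuclideanSpace ℝ
          (Fin (k + 1))) 1) × (Metric.sphere (0 : EuclideanSpace ℝ (Fin (k + 1))) 1)))) ∩ {x | x.1.2 ≠ v}) ≃ₜ
      (↥({v}ᶜ : Set (Metric.sphere (0 : EuclideanSpace ℝ (Fin (k + 1))) 1)) × ↥({v}ᶜ : Set (Metric.sphere (0 :
              EuclideanSpace ℝ (Fin (k + 1))) 1))) :=
    { toFun := fun x => (⟨x.1.1.1, x.2.1⟩, ⟨x.1.1.2, x.2.2⟩)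
      invFun := fun y => ⟨⟨(y.1.1, y.2.1), fun h => y.1.2 (congrArg Prod.fst h)⟩, y.1.2, y.2.2⟩
      left_inv := fun x => rfl
      right_inv := fun y => rfl
      continuous_toFun := by fun_prop
      continuous_invFun := by fun_prop }
  exact φ.contractibleSpace

/-- **`Hⱼ₊₁({x₁ ≠ v}) ⊕ Hⱼ₊₁({x₂ ≠ v}) ≅ Hⱼ₊₁(Sᵏ × Sᵏ ∖ (v, v))`** for `j ≥ 1`: Mayer–Vietoris for
the cover of the punctured product by `{x₁ ≠ v}` and `{x₂ ≠ v}`, whose intersection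
`(Sᵏ ∖ v) × (Sᵏ ∖ v)` is contractible (Hatcher 2002, §2.2, p. 149). [cite: HatcherAT2002, §2.2 p. 149] -/
theorem isIso_ψ_puncturedSphereProd (v : (Metric.sphere (0 : EuclideanSpace ℝ (Fin (k + 1))) 1)) (j : ℕ) (hj : 1
        ≤ j) :
    IsIso (mayerVietoris.ψ ℤ ℤ
      ({x | x.1.1 ≠ v} : Set ↥({((v, v) : (Metric.sphere (0 : EuclideanSpace ℝ (Fin (k + 1))) 1) ×
              (Metric.sphere (0 : EuclideanSpace ℝ (Fin (k + 1))) 1))}ᶜ : Set ((Metric.sphere (0 :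
              EuclideanSpace ℝ (Fin (k + 1))) 1) × (Metric.sphere (0 : EuclideanSpace ℝ (Fin (k +
              1))) 1)))) {x | x.1.2 ≠ v} (j + 1)) := by
  haveI := contractibleSpace_fst_ne_inter_snd_ne (k := k) v
  refine mayerVietoris.isIso_ψ_of_isZero _ _ ?_ ?_ (union_fst_ne_snd_ne v) j ?_ ?_
  · exact (isOpen_compl_singleton.preimage continuous_fst).preimage continuous_subtype_val
  · exact (isOpen_compl_singleton.preimage continuous_snd).preimage continuous_subtype_val
  · exact isZero_singularHomology_of_contractibleSpace ℤ ℤ (Nat.succ_ne_zero j)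
  · exact isZero_singularHomology_of_contractibleSpace ℤ ℤ (by omega)

/-- A chart of `Sᵏ × Sᵏ` about any point with values in `ℝᵏ⁺ᵏ`: the product of two charts of
the sphere followed by `ℝᵏ × ℝᵏ ≅ ℝᵏ⁺ᵏ`. [folklore] -/
theorem exists_chart_sphereProd (x : (Metric.sphere (0 : EuclideanSpace ℝ (Fin (k + 1))) 1) × (Metric.sphere (0
        : EuclideanSpace ℝ (Fin (k + 1))) 1)) :
    ∃ e : OpenPartialHomeomorph ((Metric.sphere (0 : EuclideanSpace ℝ (Fin (k + 1))) 1) × (Metric.sphere (0 :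
            EuclideanSpace ℝ (Fin (k + 1))) 1)) (RVec (k + k)), x ∈ e.source := by
  let c₁ := chartAt (EuclideanSpace ℝ (Fin k)) x.1
  let c₂ := chartAt (EuclideanSpace ℝ (Fin k)) x.2
  let θ : (EuclideanSpace ℝ (Fin k) × EuclideanSpace ℝ (Fin k)) ≃ₜ RVec (k + k) :=
    ((EuclideanSpace.equiv (Fin k) ℝ).toHomeomorph.prodCongr
        (EuclideanSpace.equiv (Fin k) ℝ).toHomeomorph).trans
      ((Homeomorph.sumArrowHomeomorphProdArrow).symm.trans
        (Homeomorph.piCongrLeft (Y := fun _ => ℝ) finSumFinEquiv))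
  refine ⟨(c₁.prod c₂).transHomeomorph θ, ?_⟩
  rw [OpenPartialHomeomorph.transHomeomorph_source, OpenPartialHomeomorph.prod_source]
  exact ⟨mem_chart_source _ x.1, mem_chart_source _ x.2⟩

/-- **Filling in the puncture: `Hⱼ₊₁(Sᵏ × Sᵏ ∖ (v, v)) ≅ Hⱼ₊₁(Sᵏ × Sᵏ)`** for `j + 2 < 2k`, by
the exact sequence of the pair and the vanishing of the local homology of the `2k`-manifold
`Sᵏ × Sᵏ` in degrees `j + 1, j + 2 ≠ 2k` (Hatcher 2002, Thm. 2.16 and §3.3 p. 231). [cite: HatcherAT2002, Thm. 2.16, §3.3 p. 231] -/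
theorem isIso_map_subsetIncl_puncturedSphereProd (v : (Metric.sphere (0 : EuclideanSpace ℝ (Fin (k + 1))) 1)) (j
        : ℕ) (h₁ : j + 1 ≠ k + k)
    (h₂ : j + 2 ≠ k + k) :
    IsIso (singularHomology.map ℤ ℤ (subsetIncl ({((v, v) : (Metric.sphere (0 : EuclideanSpace ℝ (Fin (k + 1)))
            1) × (Metric.sphere (0 : EuclideanSpace ℝ (Fin (k +
            1))) 1))}ᶜ : Set ((Metric.sphere (0 : EuclideanSpace ℝ (Fin (k + 1))) 1) × (Metric.sphere (0 : EuclideanSpace ℝ (Fin (k + 1))) 1)))) (j + 1)) := by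
  obtain ⟨e, he⟩ := exists_chart_sphereProd (k := k) ((v, v) : (Metric.sphere (0 : EuclideanSpace ℝ (Fin (k +
          1))) 1) × (Metric.sphere (0 : EuclideanSpace ℝ (Fin (k + 1))) 1))
  exact isIso_map_subsetIncl_compl_singleton _ j
    (isZero_localHomology_of_chart ℤ ℤ e he h₁) (isZero_localHomology_of_chart ℤ ℤ e he h₂)

/-- The vertical slice `y ↦ (c, y)` into the open piece `{x₁ ≠ v}` of the punctured product
(`c ≠ v`) induces isomorphisms on homology: the piece is `(Sᵏ ∖ v) × Sᵏ` with `Sᵏ ∖ v`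
contractible. [cite: HatcherAT2002, Cor. 2.11] -/
theorem isIso_map_vertSlice_fstNe (v : (Metric.sphere (0 : EuclideanSpace ℝ (Fin (k + 1))) 1)) (c : ↥({v}ᶜ : Set
        (Metric.sphere (0 : EuclideanSpace ℝ (Fin (k + 1))) 1))) (j : ℕ) :
    IsIso (singularHomology.map ℤ ℤ (⟨fun y => ⟨⟨((c : (Metric.sphere (0 : EuclideanSpace ℝ (Fin (k + 1))) 1)),
            y), fun h =>
        c.2 (congrArg Prod.fst h)⟩, c.2⟩, by fun_prop⟩ :
      C((Metric.sphere (0 : EuclideanSpace ℝ (Fin (k + 1))) 1), ↥({x | x.1.1 ≠ v} : Set ↥({((v, v) :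
              (Metric.sphere (0 : EuclideanSpace ℝ (Fin (k + 1))) 1) × (Metric.sphere (0 : EuclideanSpace ℝ (Fin
              (k + 1))) 1))}ᶜ : Set ((Metric.sphere (0 : EuclideanSpace ℝ (Fin (k + 1))) 1) × (Metric.sphere (0 : EuclideanSpace ℝ (Fin (k + 1))) 1)))))) j) := by
  haveI := contractibleSpace_sphere_compl_singleton (n := k) v
  let φ : ↥({x | x.1.1 ≠ v} : Set ↥({((v, v) : (Metric.sphere (0 : EuclideanSpace ℝ (Fin (k + 1))) 1) ×
          (Metric.sphere (0 : EuclideanSpace ℝ (Fin (k + 1))) 1))}ᶜ : Set ((Metric.sphere (0 : EuclideanSpace ℝ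
          (Fin (k + 1))) 1) × (Metric.sphere (0 : EuclideanSpace ℝ (Fin (k + 1))) 1)))) ≃ₜ
      (↥({v}ᶜ : Set (Metric.sphere (0 : EuclideanSpace ℝ (Fin (k + 1))) 1)) × (Metric.sphere (0 : EuclideanSpace
              ℝ (Fin (k + 1))) 1)) :=
    { toFun := fun x => (⟨x.1.1.1, x.2⟩, x.1.1.2)
      invFun := fun y => ⟨⟨((y.1 : (Metric.sphere (0 : EuclideanSpace ℝ (Fin (k + 1))) 1)), y.2), fun h => y.1.2
              (congrArg Prod.fst h)⟩, y.1.2⟩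
      left_inv := fun x => rfl
      right_inv := fun y => rfl
      continuous_toFun := by fun_prop
      continuous_invFun := by fun_prop }
  have hfac : (⟨fun y => ⟨⟨((c : (Metric.sphere (0 : EuclideanSpace ℝ (Fin (k + 1))) 1)), y), fun h => c.2
          (congrArg Prod.fst h)⟩, c.2⟩, by fun_prop⟩ :
      C((Metric.sphere (0 : EuclideanSpace ℝ (Fin (k + 1))) 1), ↥({x | x.1.1 ≠ v} : Set ↥({((v, v) :
              (Metric.sphere (0 : EuclideanSpace ℝ (Fin (k + 1))) 1) × (Metric.sphere (0 : EuclideanSpace ℝ (Fin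
              (k + 1))) 1))}ᶜ : Set ((Metric.sphere (0 : EuclideanSpace ℝ (Fin (k + 1))) 1) × (Metric.sphere (0 : EuclideanSpace ℝ (Fin (k + 1))) 1)))))) =
      (φ.symm : C(_, _)).comp ⟨fun y => (c, y), Continuous.prodMk continuous_const continuous_id⟩ := by
    ext y <;> rfl
  rw [hfac]
  haveI := isIso_map_prodMk_const_left (Y := (Metric.sphere (0 : EuclideanSpace ℝ (Fin (k + 1))) 1)) c j
  exact isIso_map_homeomorph_comp φ.symm _ j

/-- The horizontal slice `y ↦ (y, c)` into the open piece `{x₂ ≠ v}` of the punctured product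
(`c ≠ v`) induces isomorphisms on homology. [cite: HatcherAT2002, Cor. 2.11] -/
theorem isIso_map_horizSlice_sndNe (v : (Metric.sphere (0 : EuclideanSpace ℝ (Fin (k + 1))) 1)) (c : ↥({v}ᶜ :
        Set (Metric.sphere (0 : EuclideanSpace ℝ (Fin (k + 1))) 1))) (j : ℕ) :
    IsIso (singularHomology.map ℤ ℤ (⟨fun y => ⟨⟨(y, (c : (Metric.sphere (0 : EuclideanSpace ℝ (Fin (k + 1)))
            1))), fun h =>
        c.2 (congrArg Prod.snd h)⟩, c.2⟩, by fun_prop⟩ :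
      C((Metric.sphere (0 : EuclideanSpace ℝ (Fin (k + 1))) 1), ↥({x | x.1.2 ≠ v} : Set ↥({((v, v) :
              (Metric.sphere (0 : EuclideanSpace ℝ (Fin (k + 1))) 1) × (Metric.sphere (0 : EuclideanSpace ℝ (Fin
              (k + 1))) 1))}ᶜ : Set ((Metric.sphere (0 : EuclideanSpace ℝ (Fin (k + 1))) 1) × (Metric.sphere (0 : EuclideanSpace ℝ (Fin (k + 1))) 1)))))) j) := by
  haveI := contractibleSpace_sphere_compl_singleton (n := k) v
  let φ : ↥({x | x.1.2 ≠ v} : Set ↥({((v, v) : (Metric.sphere (0 : EuclideanSpace ℝ (Fin (k + 1))) 1) ×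
          (Metric.sphere (0 : EuclideanSpace ℝ (Fin (k + 1))) 1))}ᶜ : Set ((Metric.sphere (0 : EuclideanSpace ℝ
          (Fin (k + 1))) 1) × (Metric.sphere (0 : EuclideanSpace ℝ (Fin (k + 1))) 1)))) ≃ₜ
      ((Metric.sphere (0 : EuclideanSpace ℝ (Fin (k + 1))) 1) × ↥({v}ᶜ : Set (Metric.sphere (0 : EuclideanSpace
              ℝ (Fin (k + 1))) 1))) :=
    { toFun := fun x => (x.1.1.1, ⟨x.1.1.2, x.2⟩)
      invFun := fun y => ⟨⟨(y.1, (y.2 : (Metric.sphere (0 : EuclideanSpace ℝ (Fin (k + 1))) 1))), fun h => y.2.2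
              (congrArg Prod.snd h)⟩, y.2.2⟩
      left_inv := fun x => rfl
      right_inv := fun y => rfl
      continuous_toFun := by fun_prop
      continuous_invFun := by fun_prop }
  have hfac : (⟨fun y => ⟨⟨(y, (c : (Metric.sphere (0 : EuclideanSpace ℝ (Fin (k + 1))) 1))), fun h => c.2
          (congrArg Prod.snd h)⟩, c.2⟩, by fun_prop⟩ :
      C((Metric.sphere (0 : EuclideanSpace ℝ (Fin (k + 1))) 1), ↥({x | x.1.2 ≠ v} : Set ↥({((v, v) :
              (Metric.sphere (0 : EuclideanSpace ℝ (Fin (k + 1))) 1) × (Metric.sphere (0 : EuclideanSpace ℝ (Fin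
              (k + 1))) 1))}ᶜ : Set ((Metric.sphere (0 : EuclideanSpace ℝ (Fin (k + 1))) 1) × (Metric.sphere (0 : EuclideanSpace ℝ (Fin (k + 1))) 1)))))) =
      (φ.symm : C(_, _)).comp ⟨fun y => (y, c), Continuous.prodMk continuous_id continuous_const⟩ := by
    ext y <;> rfl
  rw [hfac]
  haveI := isIso_map_prodMk_const_right (Y := (Metric.sphere (0 : EuclideanSpace ℝ (Fin (k + 1))) 1)) c j
  exact isIso_map_homeomorph_comp φ.symm _ j

/-- **`Hₖ(Sᵏ) ⊕ Hₖ(Sᵏ) ≅ Hₖ(Sᵏ × Sᵏ)` by a vertical and a horizontal slice** (`k ≥ 2`): for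
`c, c' ≠ v` the sum of `y ↦ (c, y)` and `y ↦ (y, c')` on `Hₖ` is an isomorphism onto
`Hₖ(Sᵏ × Sᵏ; ℤ)` — Mayer–Vietoris for the punctured product (`isIso_ψ_puncturedSphereProd`), the
slices being homotopy equivalences onto the two pieces, and the puncture being invisible in degree
`k < 2k - 1` (`isIso_map_subsetIncl_puncturedSphereProd`). This is the Künneth computation
`Hₖ(Sᵏ × Sᵏ) ≅ ℤ²` (Hatcher 2002, Example 3B.3 / Thm. 3B.6) in the special case needed, proved
by Mayer–Vietoris. [cite: HatcherAT2002, §2.2 p. 149 and Thm. 3B.6] -/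
theorem isIso_biprodDesc_slices_of_ne (v : (Metric.sphere (0 : EuclideanSpace ℝ (Fin (k + 1))) 1)) (c c' :
        ↥({v}ᶜ : Set (Metric.sphere (0 : EuclideanSpace ℝ (Fin (k + 1))) 1))) (j : ℕ) (hj : 1 ≤ j)
    (h₁ : j + 1 ≠ k + k) (h₂ : j + 2 ≠ k + k) :
    IsIso (biprod.desc
      (singularHomology.map ℤ ℤ (⟨fun y => ((c : (Metric.sphere (0 : EuclideanSpace ℝ (Fin (k + 1))) 1)), y), by
              fun_prop⟩ : C((Metric.sphere (0 : EuclideanSpace ℝ (Fin (k + 1))) 1), (Metric.sphere (0 :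
              EuclideanSpace ℝ (Fin (k + 1))) 1) × (Metric.sphere (0 : EuclideanSpace ℝ (Fin (k + 1))) 1))) (j + 1))
      (singularHomology.map ℤ ℤ (⟨fun y => (y, (c' : (Metric.sphere (0 : EuclideanSpace ℝ (Fin (k + 1))) 1))),
              by fun_prop⟩ : C((Metric.sphere (0 : EuclideanSpace ℝ (Fin (k + 1))) 1), (Metric.sphere (0 :
              EuclideanSpace ℝ (Fin (k + 1))) 1) × (Metric.sphere (0 : EuclideanSpace ℝ (Fin (k + 1))) 1)))
        (j + 1))) := by
  -- notation for the pieces of the punctured product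
  set X : Set ((Metric.sphere (0 : EuclideanSpace ℝ (Fin (k + 1))) 1) × (Metric.sphere (0 : EuclideanSpace ℝ
          (Fin (k + 1))) 1)) := {((v, v) : (Metric.sphere (0 : EuclideanSpace ℝ (Fin (k +
          1))) 1) × (Metric.sphere (0 : EuclideanSpace ℝ (Fin (k + 1))) 1))}ᶜ with hX
  set U : Set ↥X := {x | x.1.1 ≠ v} with hU
  set V : Set ↥X := {x | x.1.2 ≠ v} with hV
  set sU : C((Metric.sphere (0 : EuclideanSpace ℝ (Fin (k + 1))) 1), ↥U) := ⟨fun y => ⟨⟨((c : (Metric.sphere (0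
          : EuclideanSpace ℝ (Fin (k + 1))) 1)), y), fun h => c.2 (congrArg Prod.fst h)⟩, c.2⟩,
    by fun_prop⟩ with hsU
  set sV : C((Metric.sphere (0 : EuclideanSpace ℝ (Fin (k + 1))) 1), ↥V) := ⟨fun y => ⟨⟨(y, (c' : (Metric.sphere
          (0 : EuclideanSpace ℝ (Fin (k + 1))) 1))), fun h => c'.2 (congrArg Prod.snd h)⟩, c'.2⟩,
    by fun_prop⟩ with hsV
  haveI iU : IsIso (singularHomology.map ℤ ℤ sU (j + 1)) := isIso_map_vertSlice_fstNe v c (j + 1)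
  haveI iV : IsIso (singularHomology.map ℤ ℤ sV (j + 1)) := isIso_map_horizSlice_sndNe v c' (j + 1)
  haveI iψ : IsIso (mayerVietoris.ψ ℤ ℤ U V (j + 1)) := isIso_ψ_puncturedSphereProd v j hj
  haveI iX : IsIso (singularHomology.map ℤ ℤ (subsetIncl X) (j + 1)) :=
    isIso_map_subsetIncl_puncturedSphereProd v j h₁ h₂
  -- the sum of the slices factors through these isomorphisms
  have hfac : biprod.desc
      (singularHomology.map ℤ ℤ (⟨fun y => ((c : (Metric.sphere (0 : EuclideanSpace ℝ (Fin (k + 1))) 1)), y), by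
              fun_prop⟩ : C((Metric.sphere (0 : EuclideanSpace ℝ (Fin (k + 1))) 1), (Metric.sphere (0 :
              EuclideanSpace ℝ (Fin (k + 1))) 1) × (Metric.sphere (0 : EuclideanSpace ℝ (Fin (k + 1))) 1))) (j + 1))
      (singularHomology.map ℤ ℤ (⟨fun y => (y, (c' : (Metric.sphere (0 : EuclideanSpace ℝ (Fin (k + 1))) 1))),
              by fun_prop⟩ : C((Metric.sphere (0 : EuclideanSpace ℝ (Fin (k + 1))) 1), (Metric.sphere (0 :
              EuclideanSpace ℝ (Fin (k + 1))) 1) × (Metric.sphere (0 : EuclideanSpace ℝ (Fin (k + 1))) 1))) (j + 1)) =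
      biprod.map (singularHomology.map ℤ ℤ sU (j + 1)) (singularHomology.map ℤ ℤ sV (j + 1)) ≫
        mayerVietoris.ψ ℤ ℤ U V (j + 1) ≫ singularHomology.map ℤ ℤ (subsetIncl X) (j + 1) := by
    refine biprod.hom_ext' _ _ ?_ ?_
    · rw [biprod.inl_desc, biprod.inl_map_assoc, mayerVietoris.ψ, biprod.inl_desc_assoc,
        ← singularHomology.map_comp, ← singularHomology.map_comp]
      rfl
    · rw [biprod.inr_desc, biprod.inr_map_assoc, mayerVietoris.ψ, biprod.inr_desc_assoc,
        ← singularHomology.map_comp, ← singularHomology.map_comp]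
      rfl
  rw [hfac]
  haveI : IsIso (biprod.map (singularHomology.map ℤ ℤ sU (j + 1))
      (singularHomology.map ℤ ℤ sV (j + 1))) :=
    (biprod.mapIso (asIso (singularHomology.map ℤ ℤ sU (j + 1)))
      (asIso (singularHomology.map ℤ ℤ sV (j + 1)))).isIso_hom
  infer_instance

/-- `Sᵏ` is path connected for `k ≥ 1`. [folklore] -/
theorem pathConnectedSpace_unitSphere (hk : 1 ≤ k) : PathConnectedSpace (Metric.sphere (0 : EuclideanSpace ℝ
        (Fin (k + 1))) 1) := by
  have hrank : 1 < Module.rank ℝ (EuclideanSpace ℝ (Fin (k + 1))) := by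
    apply Module.one_lt_rank_of_one_lt_finrank
    simp only [finrank_euclideanSpace, Fintype.card_fin]
    omega
  exact isPathConnected_iff_pathConnectedSpace.mp (isPathConnected_sphere hrank 0 zero_le_one)

/-- All horizontal slices `y ↦ (y, q)` of `Sᵏ × Sᵏ` are homotopic (`k ≥ 1`). [folklore] -/
theorem homotopic_horizSlice (hk : 1 ≤ k) (q q' : (Metric.sphere (0 : EuclideanSpace ℝ (Fin (k + 1))) 1)) :
    (⟨fun y => (y, q), by fun_prop⟩ : C((Metric.sphere (0 : EuclideanSpace ℝ (Fin (k + 1))) 1), (Metric.sphere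
            (0 : EuclideanSpace ℝ (Fin (k + 1))) 1) × (Metric.sphere (0 : EuclideanSpace ℝ (Fin (k +
            1))) 1))).Homotopic ⟨fun y => (y, q'), by fun_prop⟩ := by
  haveI := pathConnectedSpace_unitSphere hk
  obtain ⟨F⟩ := (ContinuousMap.homotopic_const_iff (Y := (Metric.sphere (0 : EuclideanSpace ℝ (Fin (k + 1)))
          1))).2 (PathConnectedSpace.joined q q')
  exact ⟨(ContinuousMap.Homotopy.refl (ContinuousMap.id (Metric.sphere (0 : EuclideanSpace ℝ (Fin (k + 1)))
          1))).prod F⟩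

/-- All vertical slices `y ↦ (p, y)` of `Sᵏ × Sᵏ` are homotopic (`k ≥ 1`). [folklore] -/
theorem homotopic_vertSlice (hk : 1 ≤ k) (p p' : (Metric.sphere (0 : EuclideanSpace ℝ (Fin (k + 1))) 1)) :
    (⟨fun y => (p, y), by fun_prop⟩ : C((Metric.sphere (0 : EuclideanSpace ℝ (Fin (k + 1))) 1), (Metric.sphere
            (0 : EuclideanSpace ℝ (Fin (k + 1))) 1) × (Metric.sphere (0 : EuclideanSpace ℝ (Fin (k +
            1))) 1))).Homotopic ⟨fun y => (p', y), by fun_prop⟩ := by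
  haveI := pathConnectedSpace_unitSphere hk
  obtain ⟨F⟩ := (ContinuousMap.homotopic_const_iff (Y := (Metric.sphere (0 : EuclideanSpace ℝ (Fin (k + 1)))
          1))).2 (PathConnectedSpace.joined p p')
  exact ⟨F.prod (ContinuousMap.Homotopy.refl (ContinuousMap.id (Metric.sphere (0 : EuclideanSpace ℝ (Fin (k +
          1))) 1)))⟩

/-- **`Hₖ(Sᵏ) ⊕ Hₖ(Sᵏ) ≅ Hₖ(Sᵏ × Sᵏ)` by any vertical and any horizontal slice** (`k ≥ 2`):
for all `p, q ∈ Sᵏ`, `(x, y) ↦ (p, -)_* x + (-, q)_* y` is an isomorphism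
`Hₖ(Sᵏ; ℤ) ⊕ Hₖ(Sᵏ; ℤ) ≅ Hₖ(Sᵏ × Sᵏ; ℤ)` (all slices of one kind are homotopic, `Sᵏ` being path
connected; Hatcher 2002, Thm. 3B.6 for `Sᵏ × Sᵏ`, here by Mayer–Vietoris).
[cite: HatcherAT2002, §2.2 p. 149, Cor. 2.11 and Thm. 3B.6] -/
theorem isIso_biprodDesc_slices (hk : 1 ≤ k) (p q : (Metric.sphere (0 : EuclideanSpace ℝ (Fin (k + 1))) 1)) (j :
        ℕ) (hj : 1 ≤ j)
    (h₁ : j + 1 ≠ k + k) (h₂ : j + 2 ≠ k + k) :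
    IsIso (biprod.desc
      (singularHomology.map ℤ ℤ (⟨fun y => (p, y), by fun_prop⟩ : C((Metric.sphere (0 : EuclideanSpace ℝ (Fin (k
              + 1))) 1), (Metric.sphere (0 : EuclideanSpace ℝ (Fin (k + 1))) 1) × (Metric.sphere (0 : EuclideanSpace ℝ (Fin (k + 1))) 1))) (j + 1))
      (singularHomology.map ℤ ℤ (⟨fun y => (y, q), by fun_prop⟩ : C((Metric.sphere (0 : EuclideanSpace ℝ (Fin (k
              + 1))) 1), (Metric.sphere (0 : EuclideanSpace ℝ (Fin (k + 1))) 1) × (Metric.sphere (0 : EuclideanSpace ℝ (Fin (k + 1))) 1))) (j + 1))) := by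
  -- replace `q` by `p` (homotopic slices), and puncture at the antipode `-p`
  rw [← singularHomology.map_eq_of_homotopic ℤ ℤ (homotopic_horizSlice hk p q) (j + 1)]
  have hp : p ∈ ({-p}ᶜ : Set (Metric.sphere (0 : EuclideanSpace ℝ (Fin (k + 1))) 1)) := fun h =>
    (ne_neg_of_mem_unit_sphere ℝ p) (mem_singleton_iff.1 h)
  exact isIso_biprodDesc_slices_of_ne (-p) ⟨p, hp⟩ ⟨p, hp⟩ j hj h₁ h₂

/-- **`Hₖ(Sᵏ; ℤ) ⊕ Hₖ(Sᵏ; ℤ) ≅ Hₖ(Sᵏ × Sᵏ; ℤ)` in the middle degree** (`k ≥ 2`), by any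
vertical slice `y ↦ (p, y)` and any horizontal slice `y ↦ (y, q)` (Hatcher 2002, Thm. 3B.6 for
`Sᵏ × Sᵏ`; here by Mayer–Vietoris). [cite: HatcherAT2002, Thm. 3B.6 and §2.2 p. 149] -/
theorem isIso_biprodDesc_slices_middle (hk : 2 ≤ k) (p q : (Metric.sphere (0 : EuclideanSpace ℝ (Fin (k + 1))) 1)) :
    IsIso (biprod.desc
      (singularHomology.map ℤ ℤ (⟨fun y => (p, y), by fun_prop⟩ : C((Metric.sphere (0 : EuclideanSpace ℝ (Fin (k
              + 1))) 1), (Metric.sphere (0 : EuclideanSpace ℝ (Fin (k + 1))) 1) × (Metric.sphere (0 : EuclideanSpace ℝ (Fin (k + 1))) 1))) k)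
      (singularHomology.map ℤ ℤ (⟨fun y => (y, q), by fun_prop⟩ : C((Metric.sphere (0 : EuclideanSpace ℝ (Fin (k
              + 1))) 1), (Metric.sphere (0 : EuclideanSpace ℝ (Fin (k + 1))) 1) × (Metric.sphere (0 : EuclideanSpace ℝ (Fin (k + 1))) 1))) k)) := by
  obtain ⟨j, rfl⟩ : ∃ j, k = j + 1 := ⟨k - 1, by omega⟩
  exact isIso_biprodDesc_slices (by omega) p q j (by omega) (by omega) (by omega)

/-- **`Hⱼ(Sᵏ × Sᵏ; ℤ) = 0` for `2 ≤ j ≠ k`, `j + 1 < 2k`**: by the slice isomorphism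
`Hⱼ(Sᵏ) ⊕ Hⱼ(Sᵏ) ≅ Hⱼ(Sᵏ × Sᵏ)` and `Hⱼ(Sᵏ) = 0` (Hatcher 2002, Cor. 2.14 and Thm. 3B.6).
[cite: HatcherAT2002, Cor. 2.14, Thm. 3B.6] -/
theorem isZero_singularHomology_sphereProd (hk : 1 ≤ k) {j : ℕ} (hj : 2 ≤ j) (hjk : j ≠ k)
    (hj2 : j + 1 < k + k) : IsZero (singularHomology ℤ ℤ ((Metric.sphere (0 : EuclideanSpace ℝ (Fin (k + 1))) 1)
            × (Metric.sphere (0 : EuclideanSpace ℝ (Fin (k + 1))) 1)) j) := by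
  obtain ⟨i, rfl⟩ : ∃ i, j = i + 1 := ⟨j - 1, by omega⟩
  obtain ⟨p⟩ : Nonempty (Metric.sphere (0 : EuclideanSpace ℝ (Fin (k + 1))) 1) := (pathConnectedSpace_unitSphere
          hk).nonempty
  haveI := isIso_biprodDesc_slices hk p p i (by omega) (by omega) (by omega)
  have h0 : IsZero (singularHomology ℤ ℤ (Metric.sphere (0 : EuclideanSpace ℝ (Fin (k + 1))) 1) (i + 1)) :=
    isZero_singularHomology_sphere_holds ℤ ℤ (Nat.succ_ne_zero i) hjk
  have hb : IsZero (singularHomology ℤ ℤ (Metric.sphere (0 : EuclideanSpace ℝ (Fin (k + 1))) 1) (i + 1) ⊞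
          singularHomology ℤ ℤ (Metric.sphere (0 : EuclideanSpace ℝ (Fin (k + 1))) 1) (i + 1)) :=
    (biprod_isZero_iff _ _).2 ⟨h0, h0⟩
  exact hb.of_iso (asIso (biprod.desc
    (singularHomology.map ℤ ℤ (⟨fun y => (p, y), Continuous.prodMk continuous_const continuous_id⟩ :
      C((Metric.sphere (0 : EuclideanSpace ℝ (Fin (k + 1))) 1), (Metric.sphere (0 : EuclideanSpace ℝ (Fin (k +
              1))) 1) × (Metric.sphere (0 : EuclideanSpace ℝ (Fin (k + 1))) 1))) (i + 1))
    (singularHomology.map ℤ ℤ (⟨fun y => (y, p), Continuous.prodMk continuous_id continuous_const⟩ :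
      C((Metric.sphere (0 : EuclideanSpace ℝ (Fin (k + 1))) 1), (Metric.sphere (0 : EuclideanSpace ℝ (Fin (k +
              1))) 1) × (Metric.sphere (0 : EuclideanSpace ℝ (Fin (k + 1))) 1))) (i + 1)))).symm

/-! ### Generators, Kronecker-dual classes, cup squares, and the middle cohomology lattice -/

/-- **A constant map induces `0` on `Hⱼ` for `j ≠ 0`** (it factors through a point).
[cite: HatcherAT2002, Prop. 2.8] -/
theorem singularHomology_map_eq_zero_of_forall_eq {X Y : Type} [TopologicalSpace X]
    [TopologicalSpace Y] (f : C(X, Y)) (y₀ : Y) (hf : ∀ x, f x = y₀) {j : ℕ} (hj : j ≠ 0) :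
    singularHomology.map ℤ ℤ f j = 0 := by
  have hfac : f = (ContinuousMap.const PUnit.{1} y₀).comp (ContinuousMap.const X PUnit.unit) := by
    ext x; exact hf x
  have hz : IsZero (singularHomology ℤ ℤ PUnit.{1} j) :=
    isZero_singularHomology_of_subsingleton ℤ ℤ (X := PUnit.{1}) hj
  rw [hfac, singularHomology.map_comp,
    hz.eq_of_src (singularHomology.map ℤ ℤ (ContinuousMap.const PUnit.{1} y₀) j) 0, comp_zero]

/-- **A generator of `Hₖ(Sᵏ; ℤ) ≅ ℤ` and its dual class** (`k ≥ 2`): there are a linear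
isomorphism `e : Hₖ(Sᵏ; ℤ) ≅ ℤ`, the generator `g = e⁻¹(1)`, and `σ ∈ Hᵏ(Sᵏ; ℤ)` with `⟨σ, g⟩ = 1`
— indeed `⟨σ, x⟩ = e x` for all `x` (Hatcher 2002, Cor. 2.14 and Thm. 3.2: `Hᵏ(Sᵏ) ≅ Hom(Hₖ(Sᵏ), ℤ)`
as `Hₖ₋₁(Sᵏ) = 0`). [cite: HatcherAT2002, Cor. 2.14, Thm. 3.2] -/
theorem exists_generator_sphere (hk : 2 ≤ k) :
    ∃ (e : singularHomology ℤ ℤ (Metric.sphere (0 : EuclideanSpace ℝ (Fin (k + 1))) 1) k ≃ₗ[ℤ] ℤ) (σ :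
            singularCohomology ℤ ℤ (Metric.sphere (0 : EuclideanSpace ℝ (Fin (k + 1))) 1) k),
      ∀ x, kroneckerPairing ℤ ℤ (Metric.sphere (0 : EuclideanSpace ℝ (Fin (k + 1))) 1) k σ x = e x := by
  obtain ⟨j, rfl⟩ : ∃ j, k = j + 1 := ⟨k - 1, by omega⟩
  obtain ⟨e⟩ := nonempty_singularHomology_sphere_iso_holds ℤ ℤ (n := j + 1) (by omega)
  set eL := e.toLinearEquiv ≪≫ₗ ULift.moduleEquiv with heL
  -- `H^k(Sᵏ) ≅ Hom(H_k(Sᵏ), ℤ)` since `H_{k-1}(Sᵏ) = 0`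
  have hfree : IsZero (singularHomology ℤ ℤ
      (Metric.sphere (0 : EuclideanSpace ℝ (Fin (j + 1 + 1))) 1) j) :=
    isZero_singularHomology_sphere_holds ℤ ℤ (by omega) (by omega)
  obtain ⟨σ, hσ⟩ := (kroneckerPairing_bijective_of_isZero ℤ _ j hfree).2 eL.toLinearMap
  exact ⟨eL, σ, fun x => by rw [hσ]; rfl⟩

/-- **The Kronecker-dual classes of the two slices.** Let `k ≥ 1`, `g ∈ Hₖ(Sᵏ)`, `σ ∈ Hᵏ(Sᵏ)`,
`p, q ∈ Sᵏ`, and put `A₁ = (-, q)_* g`, `A₂ = (p, -)_* g` (horizontal and vertical slices),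
`α = pr₁^* σ`, `β = pr₂^* σ`. Then `⟨α, A₁⟩ = ⟨σ, g⟩`, `⟨α, A₂⟩ = 0`, `⟨β, A₁⟩ = 0`,
`⟨β, A₂⟩ = ⟨σ, g⟩`: naturality of the Kronecker pairing (Hatcher 2002, §3.1 p. 201), `pr₁ ∘ (-, q) = id`,
and `pr₁ ∘ (p, -)` constant, inducing `0` on `Hₖ`, `k ≠ 0`. [cite: HatcherAT2002, §3.1 p. 201, Prop. 2.8] -/
theorem kroneckerPairing_slices (hk : 1 ≤ k) (g : singularHomology ℤ ℤ (Metric.sphere (0 : EuclideanSpace ℝ (Fin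
        (k + 1))) 1) k)
    (σ : singularCohomology ℤ ℤ (Metric.sphere (0 : EuclideanSpace ℝ (Fin (k + 1))) 1) k) (p q : (Metric.sphere
            (0 : EuclideanSpace ℝ (Fin (k + 1))) 1)) :
    kroneckerPairing ℤ ℤ ((Metric.sphere (0 : EuclideanSpace ℝ (Fin (k + 1))) 1) × (Metric.sphere (0 :
            EuclideanSpace ℝ (Fin (k + 1))) 1)) k (singularCohomology.map ℤ ℤ (ContinuousMap.fst : C((Metric.sphere (0 : EuclideanSpace ℝ (Fin (k + 1))) 1) × (Metric.sphere (0 : EuclideanSpace ℝ (Fin (k + 1))) 1), (Metric.sphere (0 : EuclideanSpace ℝ (Fin (k + 1))) 1))) k σ)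
        (singularHomology.map ℤ ℤ (⟨fun y => (y, q), by fun_prop⟩ : C((Metric.sphere (0 : EuclideanSpace ℝ (Fin
                (k + 1))) 1), (Metric.sphere (0 : EuclideanSpace ℝ (Fin (k +
                1))) 1) × (Metric.sphere (0 : EuclideanSpace ℝ (Fin (k + 1))) 1))) k g) =
      kroneckerPairing ℤ ℤ (Metric.sphere (0 : EuclideanSpace ℝ (Fin (k + 1))) 1) k σ g ∧
    kroneckerPairing ℤ ℤ ((Metric.sphere (0 : EuclideanSpace ℝ (Fin (k + 1))) 1) × (Metric.sphere (0 :
            EuclideanSpace ℝ (Fin (k + 1))) 1)) k (singularCohomology.map ℤ ℤ (ContinuousMap.fst : C((Metric.sphere (0 : EuclideanSpace ℝ (Fin (k + 1))) 1) × (Metric.sphere (0 : EuclideanSpace ℝ (Fin (k + 1))) 1), (Metric.sphere (0 : EuclideanSpace ℝ (Fin (k + 1))) 1))) k σ)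
        (singularHomology.map ℤ ℤ (⟨fun y => (p, y), by fun_prop⟩ : C((Metric.sphere (0 : EuclideanSpace ℝ (Fin
                (k + 1))) 1), (Metric.sphere (0 : EuclideanSpace ℝ (Fin (k +
                1))) 1) × (Metric.sphere (0 : EuclideanSpace ℝ (Fin (k + 1))) 1))) k g) = 0 ∧
    kroneckerPairing ℤ ℤ ((Metric.sphere (0 : EuclideanSpace ℝ (Fin (k + 1))) 1) × (Metric.sphere (0 :
            EuclideanSpace ℝ (Fin (k + 1))) 1)) k (singularCohomology.map ℤ ℤ (ContinuousMap.snd : C((Metric.sphere (0 : EuclideanSpace ℝ (Fin (k + 1))) 1) × (Metric.sphere (0 : EuclideanSpace ℝ (Fin (k + 1))) 1), (Metric.sphere (0 : EuclideanSpace ℝ (Fin (k + 1))) 1))) k σ)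
        (singularHomology.map ℤ ℤ (⟨fun y => (y, q), by fun_prop⟩ : C((Metric.sphere (0 : EuclideanSpace ℝ (Fin
                (k + 1))) 1), (Metric.sphere (0 : EuclideanSpace ℝ (Fin (k +
                1))) 1) × (Metric.sphere (0 : EuclideanSpace ℝ (Fin (k + 1))) 1))) k g) = 0 ∧
    kroneckerPairing ℤ ℤ ((Metric.sphere (0 : EuclideanSpace ℝ (Fin (k + 1))) 1) × (Metric.sphere (0 :
            EuclideanSpace ℝ (Fin (k + 1))) 1)) k (singularCohomology.map ℤ ℤ (ContinuousMap.snd : C((Metric.sphere (0 : EuclideanSpace ℝ (Fin (k + 1))) 1) × (Metric.sphere (0 : EuclideanSpace ℝ (Fin (k + 1))) 1), (Metric.sphere (0 : EuclideanSpace ℝ (Fin (k + 1))) 1))) k σ)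
        (singularHomology.map ℤ ℤ (⟨fun y => (p, y), by fun_prop⟩ : C((Metric.sphere (0 : EuclideanSpace ℝ (Fin
                (k + 1))) 1), (Metric.sphere (0 : EuclideanSpace ℝ (Fin (k +
                1))) 1) × (Metric.sphere (0 : EuclideanSpace ℝ (Fin (k + 1))) 1))) k g) =
      kroneckerPairing ℤ ℤ (Metric.sphere (0 : EuclideanSpace ℝ (Fin (k + 1))) 1) k σ g := by
  have hk0 : k ≠ 0 := by omega
  refine ⟨?_, ?_, ?_, ?_⟩ <;>
    rw [kroneckerPairing_map, ← ModuleCat.comp_apply, ← singularHomology.map_comp]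
  · have : (ContinuousMap.fst : C((Metric.sphere (0 : EuclideanSpace ℝ (Fin (k + 1))) 1) × (Metric.sphere (0 :
          EuclideanSpace ℝ (Fin (k + 1))) 1), (Metric.sphere (0 : EuclideanSpace ℝ (Fin (k +
          1))) 1))).comp (⟨fun y => (y, q), by fun_prop⟩ : C((Metric.sphere (0 : EuclideanSpace ℝ (Fin (k + 1))) 1), (Metric.sphere (0 : EuclideanSpace ℝ (Fin (k + 1))) 1) × (Metric.sphere (0 : EuclideanSpace ℝ (Fin (k + 1))) 1))) =
        ContinuousMap.id (Metric.sphere (0 : EuclideanSpace ℝ (Fin (k + 1))) 1) := by ext y; rfl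
    rw [this, singularHomology.map_id, ModuleCat.id_apply]
  · rw [singularHomology_map_eq_zero_of_forall_eq _ p (fun y => rfl) hk0]
    simp only [ModuleCat.hom_zero, LinearMap.zero_apply, map_zero]
  · rw [singularHomology_map_eq_zero_of_forall_eq _ q (fun y => rfl) hk0]
    simp only [ModuleCat.hom_zero, LinearMap.zero_apply, map_zero]
  · have : (ContinuousMap.snd : C((Metric.sphere (0 : EuclideanSpace ℝ (Fin (k + 1))) 1) × (Metric.sphere (0 :
          EuclideanSpace ℝ (Fin (k + 1))) 1), (Metric.sphere (0 : EuclideanSpace ℝ (Fin (k +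
          1))) 1))).comp (⟨fun y => (p, y), by fun_prop⟩ : C((Metric.sphere (0 : EuclideanSpace ℝ (Fin (k + 1))) 1), (Metric.sphere (0 : EuclideanSpace ℝ (Fin (k + 1))) 1) × (Metric.sphere (0 : EuclideanSpace ℝ (Fin (k + 1))) 1))) =
        ContinuousMap.id (Metric.sphere (0 : EuclideanSpace ℝ (Fin (k + 1))) 1) := by ext y; rfl
    rw [this, singularHomology.map_id, ModuleCat.id_apply]

/-- **`Hʲ(Sᵏ; ℤ) = 0` for `2 ≤ j ≠ k`** (universal coefficients, Hatcher 2002, Thm. 3.2, with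
Cor. 2.14). [cite: HatcherAT2002, Thm. 3.2, Cor. 2.14] -/
theorem isZero_singularCohomology_int_sphere (hk : 1 ≤ k) {j : ℕ} (hj : 2 ≤ j) (hjk : j ≠ k) :
    IsZero (singularCohomology ℤ ℤ (Metric.sphere (0 : EuclideanSpace ℝ (Fin (k + 1))) 1) j) := by
  obtain ⟨i, rfl⟩ : ∃ i, j = i + 1 := ⟨j - 1, by omega⟩
  have h1 : IsZero (singularHomology ℤ ℤ (Metric.sphere (0 : EuclideanSpace ℝ (Fin (k + 1))) 1) (i + 1)) :=
    isZero_singularHomology_sphere_holds ℤ ℤ (Nat.succ_ne_zero i) hjk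
  haveI : Subsingleton (singularHomology ℤ ℤ (Metric.sphere (0 : EuclideanSpace ℝ (Fin (k + 1))) 1) (i +
          1)) := ModuleCat.subsingleton_of_isZero h1
  haveI : Module.Free ℤ (singularHomology ℤ ℤ (Metric.sphere (0 : EuclideanSpace ℝ (Fin (k + 1))) 1) i) := by
    by_cases hik : i = k
    · -- `i = k`: then `H_i(Sᵏ) ≅ ℤ` is free
      subst hik
      obtain ⟨e⟩ := nonempty_singularHomology_sphere_iso_holds ℤ ℤ (n := i) hk
      exact Module.Free.of_equiv (e.toLinearEquiv ≪≫ₗ ULift.moduleEquiv).symm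
    · haveI : Subsingleton (singularHomology ℤ ℤ (Metric.sphere (0 : EuclideanSpace ℝ (Fin (k + 1))) 1) i) :=
        ModuleCat.subsingleton_of_isZero (isZero_singularHomology_sphere_holds ℤ ℤ (by omega) hik)
      exact Module.Free.of_subsingleton ℤ _
  haveI : Subsingleton (singularCohomology ℤ ℤ (Metric.sphere (0 : EuclideanSpace ℝ (Fin (k + 1))) 1) (i + 1)) :=
    (kroneckerPairing_bijective_of_free ℤ (Metric.sphere (0 : EuclideanSpace ℝ (Fin (k + 1))) 1) i).1.subsingleton
  exact ModuleCat.isZero_of_subsingleton _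

/-- **`pr₁^* σ ⌣ pr₁^* σ = 0 = pr₂^* σ ⌣ pr₂^* σ` in `H²ᵏ(Sᵏ × Sᵏ; ℤ)`** (`k ≥ 2`): both squares
are pulled back from `H²ᵏ(Sᵏ; ℤ) = 0` (Hatcher 2002, Prop. 3.10, Example 3.11).
[cite: HatcherAT2002, Prop. 3.10] -/
theorem cupProduct_pullback_sphere_eq_zero (hk : 2 ≤ k) (hkk : k + k = k + k)
    (π : C((Metric.sphere (0 : EuclideanSpace ℝ (Fin (k + 1))) 1) × (Metric.sphere (0 : EuclideanSpace ℝ (Fin (k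
            + 1))) 1), (Metric.sphere (0 : EuclideanSpace ℝ (Fin (k + 1))) 1))) (σ : singularCohomology ℤ ℤ (Metric.sphere (0 : EuclideanSpace ℝ (Fin (k + 1))) 1) k) :
    cupProduct hkk (singularCohomology.map ℤ ℤ π k σ) (singularCohomology.map ℤ ℤ π k σ) = 0 := by
  have h0 : IsZero (singularCohomology ℤ ℤ (Metric.sphere (0 : EuclideanSpace ℝ (Fin (k + 1))) 1) (k + k)) :=
    isZero_singularCohomology_int_sphere (by omega) (by omega) (by omega)
  haveI := ModuleCat.subsingleton_of_isZero h0
  rw [← cupProduct_map, Subsingleton.elim (cupProduct hkk σ σ) 0, map_zero]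

/-- **The middle cohomology lattice of `Sᵏ × Sᵏ`** (`k ≥ 3`): `Hᵏ(Sᵏ × Sᵏ; ℤ)` is finitely
generated and `Hᵏ(Sᵏ × Sᵏ; ℤ)/T` is free of rank `2` with basis the classes of `α = pr₁^* σ` and
`β = pr₂^* σ` (`σ` Kronecker-dual to the generator `e⁻¹ 1` of `Hₖ(Sᵏ) ≅ ℤ`), Kronecker-dual to
the slices `A₁ = (-, q)_* e⁻¹ 1`, `A₂ = (p, -)_* e⁻¹ 1` of `Hₖ(Sᵏ × Sᵏ) ≅ ℤ²` (Hatcher 2002,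
Thm. 3B.6 / Example 3.11: `H*(Sᵏ × Sᵏ)`; here `Hₖ ≅ ℤ²` by Mayer–Vietoris, `Hₖ₋₁ = 0`, and
`Hᵏ ≅ Hom(Hₖ, ℤ)` by Thm. 3.2). [cite: HatcherAT2002, Thm. 3B.6, Thm. 3.2] -/
theorem exists_basis_freeCohomology_sphereProd (hk : 3 ≤ k) (p q : (Metric.sphere (0 : EuclideanSpace ℝ (Fin (k
        + 1))) 1))
    {e : singularHomology ℤ ℤ (Metric.sphere (0 : EuclideanSpace ℝ (Fin (k + 1))) 1) k ≃ₗ[ℤ] ℤ} {σ :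
            singularCohomology ℤ ℤ (Metric.sphere (0 : EuclideanSpace ℝ (Fin (k + 1))) 1) k}
    (hσ : ∀ x, kroneckerPairing ℤ ℤ (Metric.sphere (0 : EuclideanSpace ℝ (Fin (k + 1))) 1) k σ x = e x) :
    Module.Finite ℤ (singularCohomology ℤ ℤ ((Metric.sphere (0 : EuclideanSpace ℝ (Fin (k + 1))) 1) ×
            (Metric.sphere (0 : EuclideanSpace ℝ (Fin (k + 1))) 1)) k) ∧
    ∃ b : Module.Basis (Fin 2) ℤ ↥(freeCohomology ℤ ((Metric.sphere (0 : EuclideanSpace ℝ (Fin (k + 1))) 1) ×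
            (Metric.sphere (0 : EuclideanSpace ℝ (Fin (k + 1))) 1)) k),
      b 0 = freeCohomology.mk (singularCohomology.map ℤ ℤ (ContinuousMap.fst : C((Metric.sphere (0 :
              EuclideanSpace ℝ (Fin (k + 1))) 1) × (Metric.sphere (0 : EuclideanSpace ℝ (Fin (k +
              1))) 1), (Metric.sphere (0 : EuclideanSpace ℝ (Fin (k + 1))) 1))) k σ) ∧
      b 1 = freeCohomology.mk (singularCohomology.map ℤ ℤ (ContinuousMap.snd : C((Metric.sphere (0 :
              EuclideanSpace ℝ (Fin (k + 1))) 1) × (Metric.sphere (0 : EuclideanSpace ℝ (Fin (k +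
              1))) 1), (Metric.sphere (0 : EuclideanSpace ℝ (Fin (k + 1))) 1))) k σ) := by
  classical
  -- the two slices `s₁ = (-, q)_*`, `s₂ = (p, -)_*` and the isomorphism `H_k(Sᵏ) ⊕ H_k(Sᵏ) ≅ H_k`
  set s₁ := singularHomology.map ℤ ℤ (⟨fun y => (y, q), by fun_prop⟩ : C((Metric.sphere (0 : EuclideanSpace ℝ
          (Fin (k + 1))) 1), (Metric.sphere (0 : EuclideanSpace ℝ (Fin (k +
          1))) 1) × (Metric.sphere (0 : EuclideanSpace ℝ (Fin (k + 1))) 1))) k with hs₁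
  set s₂ := singularHomology.map ℤ ℤ (⟨fun y => (p, y), by fun_prop⟩ : C((Metric.sphere (0 : EuclideanSpace ℝ
          (Fin (k + 1))) 1), (Metric.sphere (0 : EuclideanSpace ℝ (Fin (k +
          1))) 1) × (Metric.sphere (0 : EuclideanSpace ℝ (Fin (k + 1))) 1))) k with hs₂
  haveI iD := isIso_biprodDesc_slices_middle (by omega : 2 ≤ k) p q
  set g : singularHomology ℤ ℤ (Metric.sphere (0 : EuclideanSpace ℝ (Fin (k + 1))) 1) k := e.symm 1 with hg
  -- `H_k(Sᵏ) = ℤ g`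
  have hspanS : ∀ x : singularHomology ℤ ℤ (Metric.sphere (0 : EuclideanSpace ℝ (Fin (k + 1)))
          1) k, x ∈ Submodule.span ℤ ({g} : Set _) := by
    intro x
    refine Submodule.mem_span_singleton.2 ⟨e x, ?_⟩
    rw [hg, ← LinearEquiv.map_smul, smul_eq_mul, mul_one, e.symm_apply_apply]
  -- `H_k(Sᵏ × Sᵏ)` is spanned by `A₂ = s₂ g` and `A₁ = s₁ g`
  have hspanQ : (⊤ : Submodule ℤ (singularHomology ℤ ℤ ((Metric.sphere (0 : EuclideanSpace ℝ (Fin (k + 1))) 1) ×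
          (Metric.sphere (0 : EuclideanSpace ℝ (Fin (k + 1))) 1)) k)) =
      Submodule.span ℤ (({s₂ g, s₁ g} : Finset _) : Set _) := by
    refine le_antisymm ?_ le_top
    rintro x -
    set D := biprod.desc s₂ s₁ with hD
    obtain ⟨y, rfl⟩ := (asIso D).toLinearEquiv.surjective x
    have hy : (asIso D).toLinearEquiv y = D y := rfl
    rw [hy, ← show (biprod.fst ≫ biprod.inl + biprod.snd ≫ biprod.inr) ≫ D = D by
      rw [biprod.total, Category.id_comp]]
    simp only [hD, Preadditive.add_comp, Category.assoc, biprod.inl_desc, biprod.inr_desc,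
      ModuleCat.hom_add, LinearMap.add_apply, ModuleCat.hom_comp, LinearMap.comp_apply]
    rw [Finset.coe_insert, Finset.coe_singleton]
    refine Submodule.add_mem _ ?_ ?_
    · have h2 : Submodule.map s₂.hom (Submodule.span ℤ {g}) ≤ Submodule.span ℤ {s₂ g, s₁ g} := by
        rw [Submodule.map_span, Set.image_singleton]
        exact Submodule.span_mono (Set.singleton_subset_iff.2 (Set.mem_insert _ _))
      exact h2 (Submodule.mem_map_of_mem (hspanS _))
    · have h1 : Submodule.map s₁.hom (Submodule.span ℤ {g}) ≤ Submodule.span ℤ {s₂ g, s₁ g} := by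
        rw [Submodule.map_span, Set.image_singleton]
        exact Submodule.span_mono (Set.singleton_subset_iff.2
          (Set.mem_insert_of_mem _ (Set.mem_singleton _)))
      exact h1 (Submodule.mem_map_of_mem (hspanS _))
  haveI hQfin : Module.Finite ℤ (singularHomology ℤ ℤ ((Metric.sphere (0 : EuclideanSpace ℝ (Fin (k + 1))) 1) ×
          (Metric.sphere (0 : EuclideanSpace ℝ (Fin (k + 1))) 1)) k) :=
    Module.Finite.of_fg_top ⟨{s₂ g, s₁ g}, hspanQ.symm⟩
  have hrkQ : Module.finrank ℤ (singularHomology ℤ ℤ ((Metric.sphere (0 : EuclideanSpace ℝ (Fin (k + 1))) 1) ×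
          (Metric.sphere (0 : EuclideanSpace ℝ (Fin (k + 1))) 1)) k) ≤ 2 := by
    rw [← finrank_top, hspanQ]
    exact (finrank_span_finset_le_card _).trans Finset.card_le_two
  -- `H_{k-1}(Sᵏ × Sᵏ) = 0`, so `H^k ≅ Hom(H_k, ℤ)` is finitely generated, torsion-free, of rank `≤ 2`
  have hz : IsZero (singularHomology ℤ ℤ ((Metric.sphere (0 : EuclideanSpace ℝ (Fin (k + 1))) 1) ×
          (Metric.sphere (0 : EuclideanSpace ℝ (Fin (k + 1))) 1)) (k - 1)) :=
    isZero_singularHomology_sphereProd (k := k) (by omega) (j := k - 1) (by omega) (by omega)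
      (by omega)
  haveI : Subsingleton (singularHomology ℤ ℤ ((Metric.sphere (0 : EuclideanSpace ℝ (Fin (k + 1))) 1) ×
          (Metric.sphere (0 : EuclideanSpace ℝ (Fin (k + 1))) 1)) (k - 1)) := ModuleCat.subsingleton_of_isZero hz
  haveI : Module.Free ℤ (singularHomology ℤ ℤ ((Metric.sphere (0 : EuclideanSpace ℝ (Fin (k + 1))) 1) ×
          (Metric.sphere (0 : EuclideanSpace ℝ (Fin (k + 1))) 1)) (k - 1)) := Module.Free.of_subsingleton ℤ _
  haveI : Module.Finite ℤ (singularHomology ℤ ℤ ((Metric.sphere (0 : EuclideanSpace ℝ (Fin (k + 1))) 1) ×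
          (Metric.sphere (0 : EuclideanSpace ℝ (Fin (k + 1))) 1)) (k - 1)) := Module.Finite.of_finite
  have hbij := kroneckerPairing_bijective_of_free ℤ ((Metric.sphere (0 : EuclideanSpace ℝ (Fin (k + 1))) 1) ×
          (Metric.sphere (0 : EuclideanSpace ℝ (Fin (k + 1))) 1)) (k - 1)
  have htor := torsion_singularCohomology_eq_bot_of_free ℤ ((Metric.sphere (0 : EuclideanSpace ℝ (Fin (k + 1)))
          1) × (Metric.sphere (0 : EuclideanSpace ℝ (Fin (k + 1))) 1)) (k - 1)
  rw [Nat.sub_add_cancel (by omega : 1 ≤ k)] at hbij htor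
  set eK := LinearEquiv.ofBijective (kroneckerPairing ℤ ℤ ((Metric.sphere (0 : EuclideanSpace ℝ (Fin (k + 1)))
          1) × (Metric.sphere (0 : EuclideanSpace ℝ (Fin (k + 1))) 1)) k) hbij with heK
  haveI hCfin : Module.Finite ℤ (singularCohomology ℤ ℤ ((Metric.sphere (0 : EuclideanSpace ℝ (Fin (k + 1))) 1)
          × (Metric.sphere (0 : EuclideanSpace ℝ (Fin (k + 1))) 1)) k) :=
    finite_singularCohomology_of_finite_singularHomology (R := ℤ) (N := ℤ) (X := (Metric.sphere (0 :
            EuclideanSpace ℝ (Fin (k + 1))) 1) × (Metric.sphere (0 : EuclideanSpace ℝ (Fin (k + 1))) 1)) k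
      fun m hm => by
        obtain rfl : m = k - 1 := by omega
        infer_instance
  have hrkC : Module.finrank ℤ (singularCohomology ℤ ℤ ((Metric.sphere (0 : EuclideanSpace ℝ (Fin (k + 1))) 1) ×
          (Metric.sphere (0 : EuclideanSpace ℝ (Fin (k + 1))) 1)) k) ≤ 2 := by
    rw [eK.finrank_eq, finrank_dual_eq]; exact hrkQ
  -- `H^k/T ≅ H^k` (no torsion)
  have hinj : Function.Injective (freeCohomology.mk (R := ℤ) (X := (Metric.sphere (0 : EuclideanSpace ℝ (Fin (k
          + 1))) 1) × (Metric.sphere (0 : EuclideanSpace ℝ (Fin (k + 1))) 1)) (k := k)) := by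
    rw [← LinearMap.ker_eq_bot, freeCohomology.ker_mk]; exact htor
  set eF := LinearEquiv.ofBijective _ ⟨hinj, freeCohomology.mk_surjective (R := ℤ)
    (X := (Metric.sphere (0 : EuclideanSpace ℝ (Fin (k + 1))) 1) × (Metric.sphere (0 : EuclideanSpace ℝ (Fin (k
            + 1))) 1)) (k := k)⟩ with heF
  haveI : Module.IsTorsionFree ℤ (singularCohomology ℤ ℤ ((Metric.sphere (0 : EuclideanSpace ℝ (Fin (k + 1))) 1)
          × (Metric.sphere (0 : EuclideanSpace ℝ (Fin (k + 1))) 1)) k) :=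
    (Submodule.isTorsionFree_iff_torsion_eq_bot).2 htor
  haveI : Module.Free ℤ (singularCohomology ℤ ℤ ((Metric.sphere (0 : EuclideanSpace ℝ (Fin (k + 1))) 1) ×
          (Metric.sphere (0 : EuclideanSpace ℝ (Fin (k + 1))) 1)) k) := Module.free_of_finite_type_torsion_free'
  haveI : Module.Finite ℤ ↥(freeCohomology ℤ ((Metric.sphere (0 : EuclideanSpace ℝ (Fin (k + 1))) 1) ×
          (Metric.sphere (0 : EuclideanSpace ℝ (Fin (k + 1))) 1)) k) := Module.Finite.equiv eF
  haveI : Module.Free ℤ ↥(freeCohomology ℤ ((Metric.sphere (0 : EuclideanSpace ℝ (Fin (k + 1))) 1) ×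
          (Metric.sphere (0 : EuclideanSpace ℝ (Fin (k + 1))) 1)) k) := Module.Free.of_equiv eF
  have hrk : Module.finrank ℤ ↥(freeCohomology ℤ ((Metric.sphere (0 : EuclideanSpace ℝ (Fin (k + 1))) 1) ×
          (Metric.sphere (0 : EuclideanSpace ℝ (Fin (k + 1))) 1)) k) ≤ 2 := by
    rw [← eF.finrank_eq]; exact hrkC
  -- the functionals "evaluate on `A₁`, `A₂`" and the vectors `ᾱ`, `β̄` have the unit matrix
  set A : Fin 2 → singularHomology ℤ ℤ ((Metric.sphere (0 : EuclideanSpace ℝ (Fin (k + 1))) 1) × (Metric.sphere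
          (0 : EuclideanSpace ℝ (Fin (k + 1))) 1)) k := ![s₁ g, s₂ g] with hA
  set c : Fin 2 → singularCohomology ℤ ℤ ((Metric.sphere (0 : EuclideanSpace ℝ (Fin (k + 1))) 1) ×
          (Metric.sphere (0 : EuclideanSpace ℝ (Fin (k + 1))) 1)) k :=
    ![singularCohomology.map ℤ ℤ (ContinuousMap.fst : C((Metric.sphere (0 : EuclideanSpace ℝ (Fin (k + 1))) 1) ×
            (Metric.sphere (0 : EuclideanSpace ℝ (Fin (k + 1))) 1), (Metric.sphere (0 : EuclideanSpace ℝ (Fin (k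
            + 1))) 1))) k σ,
      singularCohomology.map ℤ ℤ (ContinuousMap.snd : C((Metric.sphere (0 : EuclideanSpace ℝ (Fin (k + 1))) 1) ×
              (Metric.sphere (0 : EuclideanSpace ℝ (Fin (k + 1))) 1), (Metric.sphere (0 : EuclideanSpace ℝ (Fin
              (k + 1))) 1))) k σ] with hc
  have hL : ∀ i : Fin 2, ∃ L : singularCohomology ℤ ℤ ((Metric.sphere (0 : EuclideanSpace ℝ (Fin (k + 1))) 1) ×
          (Metric.sphere (0 : EuclideanSpace ℝ (Fin (k + 1))) 1)) k →ₗ[ℤ] ℤ,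
      ∀ a, L a = kroneckerPairing ℤ ℤ ((Metric.sphere (0 : EuclideanSpace ℝ (Fin (k + 1))) 1) × (Metric.sphere
              (0 : EuclideanSpace ℝ (Fin (k + 1))) 1)) k a (A i) := fun i =>
    exists_linearMap_apply₂ (kroneckerPairing ℤ ℤ ((Metric.sphere (0 : EuclideanSpace ℝ (Fin (k + 1))) 1) ×
            (Metric.sphere (0 : EuclideanSpace ℝ (Fin (k + 1))) 1)) k) (A i)
  choose L hLa using hL
  set f : Fin 2 → (↥(freeCohomology ℤ ((Metric.sphere (0 : EuclideanSpace ℝ (Fin (k + 1))) 1) × (Metric.sphere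
          (0 : EuclideanSpace ℝ (Fin (k + 1))) 1)) k) →ₗ[ℤ] ℤ) :=
    fun i => (L i).comp eF.symm.toLinearMap with hf
  set v : Fin 2 → ↥(freeCohomology ℤ ((Metric.sphere (0 : EuclideanSpace ℝ (Fin (k + 1))) 1) × (Metric.sphere (0
          : EuclideanSpace ℝ (Fin (k + 1))) 1)) k) := fun i => freeCohomology.mk (c i) with hv
  have hσ1 : kroneckerPairing ℤ ℤ (Metric.sphere (0 : EuclideanSpace ℝ (Fin (k + 1))) 1) k σ g = 1 := by rw [hσ,
          hg, e.apply_symm_apply]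
  obtain ⟨h11, h12, h21, h22⟩ := kroneckerPairing_slices (k := k) (by omega) g σ p q
  have hfv : ∀ i i', f i' (v i) = kroneckerPairing ℤ ℤ ((Metric.sphere (0 : EuclideanSpace ℝ (Fin (k + 1))) 1) ×
          (Metric.sphere (0 : EuclideanSpace ℝ (Fin (k + 1))) 1)) k (c i) (A i') := by
    intro i i'
    have hci : freeCohomology.mk (c i) = eF (c i) := rfl
    simp only [hf, hv, LinearMap.comp_apply, LinearEquiv.coe_toLinearMap, hLa, hci,
      LinearEquiv.symm_apply_apply]
  have hmat : (Matrix.of fun i i' => f i' (v i)) = 1 := by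
    ext i i'
    rw [Matrix.of_apply, hfv]
    fin_cases i <;> fin_cases i'
    · simpa [hc, hA] using h11.trans hσ1
    · simpa [hc, hA] using h12
    · simpa [hc, hA] using h21
    · simpa [hc, hA] using h22.trans hσ1
  obtain ⟨b, hb⟩ := exists_basis_of_isUnit_eval hrk f v (by rw [hmat]; exact isUnit_one)
  exact ⟨hCfin, b, hb 0, hb 1⟩

end SphereProd

end Literature.Topology.FourManifolds

end
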